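import Mathlib
import HarnessLib
import Summits.HubbardSuperconductivity.HubbardSuperconductivity.Theorems.KLProgrammeKLRegimeSectorSlicePairWtFat
import Summits.HubbardSuperconductivity.HubbardSuperconductivity.Theorems.KLProgrammeKLRegimeAlphaFatClosed
import Summits.HubbardSuperconductivity.HubbardSuperconductivity.Theorems.KLProgrammeKLRegimeAlphaWtScalars
import Summits.HubbardSuperconductivity.HubbardSuperconductivity.Theorems.KLProgrammeKLRegimeAlphaWtScalars2

/-!
# Route `KLProgramme` — engine support, route (L2), FAT layer, WEIGHTED: the uniform WEIGHTED per-pair bound at the engine's slice with the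
# canonical cube-root-free rates, SHIFTED slice `(Λₛ, Λ′]`, `Λ_{m+1} = r·Λₛ`, `r ≥ 1` — all five rate inequalities DISCHARGED (raw form)

Cell `gate-hubbard-kl`, seat p3 (g10); program «W3α = α_w rows instance», file (α2b-1): weighted twin of the rate part of k3c2-p3's
`slicePair_bgmFat_closed`.  Rates `s₀ = 2Λβ/(MπX₀)`, `s₁ = 2Λ/(πX₁)`, `s₂ = 2Λ/(π(N_r+½)X₁)`, `s₃ = 2/(π(N_r+½)N_r√q_v)`, `s₃′ = 2Λ/(π(N_r+½)X₃)`,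
`X₀ = max 1 D_t3`, `X₁ = max 1 q₃ᵉ`, `X₃ = max 1 q₃ᵛ` (`q ≤ X³`), all with `Λ ↦ Λₛ`; `Λ = klScale e₀ (m+1) = rΛₛ`, `Λ_m = 4Λ`, `N_r = 2^{m+1}`.

* **`slicePairWt_bgmFat_closed_shift_raw`** — the bound of `slicePairWt_bgmFat_le` at these rates (`Λ ↦ Λₛ` on the propagator side,
  `q_v` read at `e₀/r`), for every pair `(ω, ω′)`; the door's instance is `r = 16` (fat family `n`, slice `n+2`).

Everything is proved; no definitions. [cite: BenfattoGiulianiMastropietro2006, §2.8 (2.81), §3 (3.3)]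
-/

noncomputable section

namespace Summit.HubbardSuperconductivity.HubbardSuperconductivity.Theorems.TorusFourierL2

set_option linter.dupNamespace false -- summit = problem name (single-conjunct summit), D-0017

open Set Finset Literature.MathematicalPhysics.QuantumLattice Literature.MathematicalPhysics.QuantumLattice.BandSectorCounting
open Literature.MathematicalPhysics.QuantumLattice.FermiRG Literature.Probability.LatticeModels Literature.Analysis.SpecialFunctions
open Summit.HubbardSuperconductivity.HubbardSuperconductivity.Theorems.DispersionFlow
open Summit.HubbardSuperconductivity.HubbardSuperconductivity.Theorems.KLRegimeSplit
open Summit.HubbardSuperconductivity.HubbardSuperconductivity.Theorems.KLProgrammeLegKernels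
open Summit.HubbardSuperconductivity.HubbardSuperconductivity.Theorems.PerturbedFermiCurve
open scoped Real Nat

section Closed

open Classical

variable {L M : ℕ} [NeZero L] [NeZero M] {a b : ℝ} (B : BandBounds a b) {K : TrigPolyC4v} {A : ℝ}
  (hA : ∀ p : Momentum, ∀ j ≤ 2, ‖iteratedFDeriv ℝ j (frameShift K) p‖ ≤ A) (hADt : 2 * A < B.Dtmin)
  {μ e₀ z β : ℝ} (he : 0 < e₀) (hz : 0 < z) (hz1 : z ≤ 1) (hgap : e₀ + A + z ^ 2 < -μ) (h3 : e₀ + A - μ ≤ 3)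
  (hlo : a ≤ μ - A - e₀) (hhi : μ + A + e₀ ≤ b) (hβ : 0 < β) (hρA : 4 * A < 2 * B.rhomin)
  (m : ℕ) (hMm : klScale e₀ m * β < π * (2 * M - 5))
  {d : ℝ} (hd : 0 ≤ d) (hd1 : ∀ u, |deriv (bgmCutoffSq e₀) u| ≤ d) (hd2 : ∀ u, |iteratedDeriv 2 (bgmCutoffSq e₀) u| ≤ d)
  (hd3 : ∀ u, |iteratedDeriv 3 (bgmCutoffSq e₀) u| ≤ d)
  {A₃ a₃ : ℝ} (hA3 : ∀ p : Momentum, ‖iteratedFDeriv ℝ 3 (frameShift K) p‖ ≤ A₃) (ha3 : A₃ * klScale e₀ m ^ 2 ≤ a₃)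
  {Ba : ℝ} (hB0 : 0 ≤ Ba)
  (hB : ∀ (i : ℕ), i ≤ 2 → ∀ (n : ℕ) (ω : ℤ) (θ₀ : ℝ) (q w : Fin 2 → ℝ) (t : ℝ) {r₀ : ℝ}, 0 < r₀ →
    r₀ ≤ ‖momToComplex (q + t • w)‖ → |sectorRelAngle θ₀ (q + t • w)| < π →
    ‖iteratedDeriv i (fun t : ℝ => sectorWeightCirc n ω (polarAngle (q + t • w))) t‖ ≤
      (2 : ℕ)! * Ba * ((1 + (sectorWidth n)⁻¹ * (2 : ℕ)!) * ‖momToComplex w‖ / r₀) ^ i)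
  {Ba3 : ℝ} (hB30 : 0 ≤ Ba3)
  (hB3 : ∀ (i : ℕ), i ≤ 3 → ∀ (n : ℕ) (ω : ℤ) (θ₀ : ℝ) (q w : Fin 2 → ℝ) (t : ℝ) {r₀ : ℝ}, 0 < r₀ →
    r₀ ≤ ‖momToComplex (q + t • w)‖ → |sectorRelAngle θ₀ (q + t • w)| < π →
    ‖iteratedDeriv i (fun t : ℝ => sectorWeightCirc n ω (polarAngle (q + t • w))) t‖ ≤
      (3 : ℕ)! * Ba3 * ((1 + (sectorWidth n)⁻¹ * (3 : ℕ)!) * ‖momToComplex w‖ / r₀) ^ i)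
  {Λs Λ' r : ℝ} (hΛs : 0 < Λs) (hr : 1 ≤ r) (hΛsr : klScale e₀ (m + 1) = r * Λs) (hΛΛ' : Λs ≤ Λ') (hM' : Λ' < π * (2 * M - 5) / β)
  {K₁ K₂ K₃ : ℝ} (hK₁pos : 0 < K₁) (hK₁ : ∀ p, ‖fderiv ℝ (frameLevel μ K) p‖ ≤ K₁) (hK₂ : ∀ p, ‖iteratedFDeriv ℝ 2 (frameLevel μ K) p‖ ≤ K₂)
  (hK₃ : ∀ p, ‖iteratedFDeriv ℝ 3 (frameLevel μ K) p‖ ≤ K₃)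
  {B₁ B₂ B₃ : ℝ} (hB₁ : ∀ x, |deriv salmhoferCutoff x| ≤ B₁) (hB₂ : ∀ x, |deriv (deriv salmhoferCutoff) x| ≤ B₂)
  (hB₃ : ∀ x, |deriv (deriv (deriv salmhoferCutoff)) x| ≤ B₃)
  (hLz : 3 * |2 * π / L| * ((2 : ℝ) ^ (m + 1) + 1 / 2) ≤ z) (hLN : 2 * π * (2 : ℝ) ^ (m + 1) * ((2 : ℝ) ^ (m + 1) + 1 / 2) ≤ L)
  {R₀ : ℕ} (hR₀ : 2 * (2 * (2 : ℝ) ^ (m + 1) + 1) * (R₀ : ℝ) < L)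
  {cρ G₁ G₂ G₃ κ₃F Kp bτ ae1 ae2 av1 av2 qv Dt3 q3e q3v X₀ X₁ X₃ : ℝ}
  (hcρ : cρ = (2 * e₀ / π + B.smax * B.Dtmin * (3 / 4)) / (B.Dtmin - 2 * A) + π * Real.sqrt 2 * (1 + (4 + 2 * A) / (B.Dtmin - 2 * A)))
  (hG₁ : G₁ = d * e₀ ^ 2 * 1 + 1 * (d * e₀ ^ 2)) (hG₂ : G₂ = d * e₀ ^ 4 * 1 + 2 * (d * e₀ ^ 2) * (d * e₀ ^ 2) + 1 * (d * e₀ ^ 4))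
  (hG₃ : G₃ = d * e₀ ^ 6 * 1 + 3 * (d * e₀ ^ 4) * (d * e₀ ^ 2) + 3 * (d * e₀ ^ 2) * (d * e₀ ^ 4) + 1 * (d * e₀ ^ 6))
  (hκ₃F : κ₃F = (8 * G₃ + 12 * G₂) * (4 + 2 * A) ^ 3 + (12 * G₂ + 6 * G₁) * (4 + 2 * A) * (4 + 4 * A) * e₀ +
      2 * G₁ * (4 * e₀ ^ 2 + 8 * a₃) +
      216 * 9 * Ba3 * ((4 * G₂ + 2 * G₁) * (4 + 2 * A) ^ 2 * (2 * e₀) + 2 * G₁ * (4 + 4 * A) * e₀ * (2 * e₀)) +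
      216 * 9 * G₁ * (4 + 2 * A) * (12 * Ba3 + 72 * Ba3 ^ 2) * (2 * e₀) ^ 2 + 216 * 9 * (12 * Ba3 + 216 * Ba3 ^ 2) * (2 * e₀) ^ 3)
  (hKp : Kp = 4 + 4 * A) (hbτ : bτ = 4 + 2 * A + 2 * K₂ * (cρ * π))
  (hae1 : ae1 = G₁ * (4 + 2 * A + Kp * (cρ * π + 2)) / 2 + 72 * Ba * e₀)
  (hae2 : ae2 = (4 * G₂ + 2 * G₁) * (4 + 2 * A + Kp * (cρ * π + 2)) ^ 2 / 16 + G₁ * Kp * e₀ / 2 +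
    144 * G₁ * (4 + 2 * A + Kp * (cρ * π + 2)) * Ba * e₀ + 36 * (4 * Ba + 8 * Ba ^ 2) * e₀ ^ 2)
  (hav1 : av1 = G₁ * (4 + 2 * A + Kp * (cρ * π + 2)) / (2 * e₀) + 288 * Ba)
  (hav2 : av2 = (4 * G₂ + 2 * G₁) * (4 + 2 * A + Kp * (cρ * π + 2)) ^ 2 / (16 * e₀ ^ 2) + G₁ * Kp / (2 * e₀) +
    144 * G₁ * (4 + 2 * A + Kp * (cρ * π + 2)) * Ba / e₀ + 144 * (4 * Ba + 8 * Ba ^ 2))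
  (hqv : qv = (32 * B₂ + 144 * B₁ + 128) * (bτ + 8 * K₂) ^ 2 / (4 * (e₀ / r) ^ 2) + (16 * B₁ + 16) * K₂ / (2 * (e₀ / r)) +
    av1 * (16 * B₁ + 16) * (bτ + 6 * K₂) / (2 * (e₀ / r)) + av2)
  (hDt3 : Dt3 = 2 * (64 * B₃ + 480 * B₂ + 1728 * B₁ + 1536) + 3 * G₁ * (32 * B₂ + 144 * B₁ + 128) +
    3 / 8 * (4 * G₂ + 2 * G₁) * (16 * B₁ + 16) + (8 * G₃ + 12 * G₂) / 8)
  (hq3e : q3e = (64 * B₃ + 480 * B₂ + 1728 * B₁ + 1536) * (Real.sqrt 2 * K₁ + 12 * K₂) ^ 3 / 4 +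
    3 / 2 * (32 * B₂ + 144 * B₁ + 128) * K₂ * (Real.sqrt 2 * K₁ + 12 * K₂) * e₀ + Real.sqrt 2 / 2 * (16 * B₁ + 16) * K₃ * e₀ ^ 2 +
    3 * ae1 * ((32 * B₂ + 144 * B₁ + 128) * (Real.sqrt 2 * K₁ + 10 * K₂) ^ 2 / 4 + (16 * B₁ + 16) * K₂ * e₀ / 2) +
    3 / 4 * ae2 * (16 * B₁ + 16) * (Real.sqrt 2 * K₁ + 8 * K₂) + κ₃F / 64)
  (hq3v : q3v = (64 * B₃ + 480 * B₂ + 1728 * B₁ + 1536) * (bτ + 12 * K₂) ^ 3 / 4 +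
    3 / 2 * (32 * B₂ + 144 * B₁ + 128) * K₂ * (bτ + 12 * K₂) * e₀ + Real.sqrt 2 / 2 * (16 * B₁ + 16) * K₃ * e₀ ^ 2 +
    3 * (e₀ * av1 / 2) * ((32 * B₂ + 144 * B₁ + 128) * (bτ + 10 * K₂) ^ 2 / 4 + (16 * B₁ + 16) * K₂ * e₀ / 2) +
    3 / 4 * (e₀ ^ 2 * av2) * (16 * B₁ + 16) * (bτ + 8 * K₂) + κ₃F / 64)
  (hX₀ : X₀ = max 1 Dt3) (hX₁ : X₁ = max 1 q3e) (hX₃ : X₃ = max 1 q3v)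

include B hA hADt he hz hz1 hgap h3 hlo hhi hβ hρA hMm hd hd1 hd2 hd3 hA3 ha3 hB0 hB hB30 hB3 hΛs hr hΛsr hΛΛ' hM' hK₁pos hK₁ hK₂ hK₃ hB₁ hB₂ hB₃
  hLz hLN hR₀ hcρ hG₁ hG₂ hG₃ hκ₃F hKp hbτ hae1 hae2 hav1 hav2 hqv hDt3 hq3e hq3v hX₀ hX₁ hX₃

set_option maxHeartbeats 3000000 in
/-- **The uniform WEIGHTED per-pair bound at the canonical rates, raw form** (all five rate inequalities discharged; the weight bracket and
the support count still in the form of `slicePairWt_bgmFat_le`). [cite: BenfattoGiulianiMastropietro2006, §2.8 (2.81)] -/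
theorem slicePairWt_bgmFat_closed_shift_raw (ω ω' : Fin (sectorCount (m + 1))) :
    ∑ zz : TorusSite 1 (2 * M) × TorusSite 2 L,
        (1 + 2 * Λs * β / ((M : ℝ) * π * X₀) * |(((zz.1 0).valMinAbs : ℤ) : ℝ)| +
            2 * Λs / (π * X₁) * |(((zz.2 0).valMinAbs : ℤ) : ℝ)| +
            2 * Λs / (π * X₁) * |(((zz.2 1).valMinAbs : ℤ) : ℝ)|) *
        ‖∑ q : TorusSite 1 (2 * M) × TorusSite 2 L, (torusChar q.1 zz.1 * torusChar q.2 zz.2) •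
          ((((1 / (β * (L : ℝ) ^ 2) : ℝ) : ℂ) ^ 2 *
            (bgmFatMultiplier L M e₀ β (nambuXiCT L μ K) (m + 1) ω (⟨(q.1 0).val, ZMod.val_lt (q.1 0)⟩, q.2) *
              bgmFatMultiplier L M e₀ β (nambuXiCT L μ K) (m + 1) ω' (⟨(q.1 0).val, ZMod.val_lt (q.1 0)⟩, q.2) *
              sliceSymbolFnXi (β * (L : ℝ) ^ 2) 0 Λs Λ' (matsubaraFreq β M ⟨(q.1 0).val, ZMod.val_lt (q.1 0)⟩)
                (nambuXiCT L μ K q.2))))‖ ≤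
      Real.sqrt (524288 * (1 / (2 * Λs * β / ((M : ℝ) * π * X₀)) + 1) *
          ((1 + 2 * Real.sqrt 2 * (2 * Λs / (π * X₁)) /
                (2 * Λs / (π * ((2 : ℝ) ^ (m + 1) + 1 / 2) * X₁) * ((2 : ℝ) ^ (m + 1) - 1)) +
              2 * Real.sqrt 2 * (2 * Λs / (π * X₁)) /
                (2 * Λs / (π * ((2 : ℝ) ^ (m + 1) + 1 / 2) * X₃) * ((2 : ℝ) ^ (m + 1) - 1))) ^ 2 *
            ((2 * Real.sqrt 2 / (2 * Λs / (π * ((2 : ℝ) ^ (m + 1) + 1 / 2) * X₁) * ((2 : ℝ) ^ (m + 1) - 1)) + 2) *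
              (2 * Real.sqrt 2 / (2 / (π * ((2 : ℝ) ^ (m + 1) + 1 / 2) * (2 : ℝ) ^ (m + 1) * Real.sqrt qv) * ((2 : ℝ) ^ (m + 1) - 1)) + 2))
            + (1 / (2 * Λs / (π * X₁)) + 1) ^ 2 / (1 + (2 * Λs / (π * X₁)) * R₀))) *
        Real.sqrt (24 * (2 * M : ℕ) * (L : ℝ) ^ 2 *
          ((klScale e₀ m * β / π + 1) *
            ((Real.sqrt 2 * L * ((klScale e₀ m + (4 + 4 * A) *
                ((klScale e₀ m + B.smax * B.Dtmin * (3 * sectorWidth (m + 1) / 4)) / (B.Dtmin - 2 * A) +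
                  π * Real.sqrt 2 * (1 + (4 + 2 * A) / (B.Dtmin - 2 * A)) * sectorWidth (m + 1)) ^ 2) / (2 * B.rhomin - 4 * A)) / π + 2) *
              (Real.sqrt 2 * L * (2 * ((klScale e₀ m + B.smax * B.Dtmin * (3 * sectorWidth (m + 1) / 4)) / (B.Dtmin - 2 * A) +
                  π * Real.sqrt 2 * (1 + (4 + 2 * A) / (B.Dtmin - 2 * A)) * sectorWidth (m + 1))) / π + 2)))) *
        ((1 / (β * (L : ℝ) ^ 2)) ^ 2 * (4 * (β * (L : ℝ) ^ 2) / Λs)) := by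
  have hπ := Real.pi_pos; have hL : (0 : ℝ) < L := Nat.cast_pos.2 (Nat.pos_of_ne_zero (NeZero.ne L))
  have hMpos : (0 : ℝ) < M := Nat.cast_pos.2 (Nat.pos_of_ne_zero (NeZero.ne M))
  set Λ : ℝ := klScale e₀ (m + 1) with hΛdef
  set Nr : ℝ := (2 : ℝ) ^ (m + 1) with hNrdef
  have hΛ : 0 < Λ := by rw [hΛdef, klScale]; positivity
  have hNr2 : 2 ≤ Nr := by
    rw [hNrdef]
    calc (2 : ℝ) = 2 ^ 1 := by norm_num
      _ ≤ 2 ^ (m + 1) := pow_le_pow_right₀ (by norm_num) (by omega)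
  have hNr0 : 0 < Nr := (by linarith only [hNr2]); have hNr1 : 1 ≤ Nr := by linarith only [hNr2]
  have hNrsq : Nr ^ 2 = (4 : ℝ) ^ (m + 1) := by
    rw [hNrdef, ← pow_mul, show (4 : ℝ) = 2 ^ 2 by norm_num, ← pow_mul]; ring_nf
  have hNrΛ : Nr ^ 2 * Λ = e₀ := by rw [hNrsq, hΛdef, klScale]; field_simp
  have hΛm : klScale e₀ m = 4 * Λ := by rw [hΛdef, klScale, klScale, pow_succ]; field_simp
  have hΛm0 : 0 < klScale e₀ m := (by rw [hΛm]; positivity); have hΛe : Λ ≤ e₀ := klScale_le_e0 he.le (m + 1)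
  have hr0 : 0 < r := lt_of_lt_of_le one_pos hr; have hΛsr' : Λ = r * Λs := by rw [hΛdef]; exact hΛsr
  have hΛsΛ : Λs ≤ Λ := (by rw [hΛsr']; exact le_mul_of_one_le_left hΛs.le hr); have hΛse : Λs ≤ e₀ := hΛsΛ.trans hΛe
  have hNrΛ' : Nr * Λ ≤ e₀ / 2 := by
    have : Nr * Λ = e₀ / Nr := by
      rw [eq_div_iff hNr0.ne', ← hNrΛ]; ring
    rw [this]; exact div_le_div_of_nonneg_left he.le (by norm_num) hNr2
  have hNrΛs : Nr ^ 2 * Λs = e₀ / r := by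
    rw [eq_div_iff hr0.ne', ← hNrΛ, hΛsr']; ring
  have hw : sectorWidth (m + 1) = π / Nr := by rw [sectorWidth, hNrdef]
  have hwsi : 1 + 2 * (sectorWidth (m + 1))⁻¹ ≤ 2 * Nr := by
    rw [hw, inv_div]
    have : 2 * (Nr / π) ≤ Nr := by
      rw [mul_div_assoc']; rw [div_le_iff₀ hπ]; nlinarith only [Real.pi_gt_three, hNr0]
    linarith only [this, hNr2]
  have hwsi0 : 0 ≤ (sectorWidth (m + 1))⁻¹ := by rw [hw]; positivity
  have hA0 : 0 ≤ A := (norm_nonneg _).trans (hA 0 0 (by norm_num))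
  have hK10 : 0 ≤ K₁ := hK₁pos.le; have hK20 : 0 ≤ K₂ := le_trans (norm_nonneg _) (hK₂ 0); have hK30 : 0 ≤ K₃ := le_trans (norm_nonneg _) (hK₃ 0)
  have hB10 : 0 ≤ B₁ := (abs_nonneg _).trans (hB₁ 0); have hB20 : 0 ≤ B₂ := (abs_nonneg _).trans (hB₂ 0)
  have hB30' : 0 ≤ B₃ := (abs_nonneg _).trans (hB₃ 0)
  have hDt0 : 0 < B.Dtmin - 2 * A := (by linarith only [hADt]); have hγ : 0 < 2 * B.rhomin - 4 * A := by linarith only [hρA]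
  have hcρ0 : 0 ≤ cρ := by rw [hcρ]; have := B.smax_pos; have := B.Dtmin_pos; positivity
  have hG₁0 : 0 ≤ G₁ := (by rw [hG₁]; positivity); have hG₂0 : 0 ≤ G₂ := (by rw [hG₂]; positivity); have hG₃0 : 0 ≤ G₃ := by rw [hG₃]; positivity
  have hA30 : 0 ≤ A₃ := le_trans (norm_nonneg _) (hA3 0); have ha30 : 0 ≤ a₃ := le_trans (by positivity) ha3
  have hκ₃F0 : 0 ≤ κ₃F := by rw [hκ₃F]; positivity
  have hKp0 : 0 ≤ Kp := (by rw [hKp]; positivity); have hbτ0 : 0 ≤ bτ := by rw [hbτ]; positivity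
  have hae10 : 0 ≤ ae1 := (by rw [hae1]; positivity); have hae20 : 0 ≤ ae2 := by rw [hae2]; positivity
  have hav10 : 0 ≤ av1 := (by rw [hav1]; positivity); have hav20 : 0 ≤ av2 := by rw [hav2]; positivity
  have hqv0 : 0 < qv := by
    rw [hqv]
    have : 0 < (32 * B₂ + 144 * B₁ + 128) * (bτ + 8 * K₂) ^ 2 / (4 * (e₀ / r) ^ 2) := by
      have : 0 < bτ + 8 * K₂ := by rw [hbτ]; positivity
      positivity
    positivity
  obtain ⟨hX₀c, hX₀0⟩ := le_max_one_pow_three Dt3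
  obtain ⟨hX₁c, hX₁0⟩ := le_max_one_pow_three q3e
  obtain ⟨hX₃c, hX₃0⟩ := le_max_one_pow_three q3v
  rw [← hX₀] at hX₀c hX₀0; rw [← hX₁] at hX₁c hX₁0; rw [← hX₃] at hX₃c hX₃0
  set ℓ₁ : ℝ := 2 * π / L with hℓ₁
  set ℓ : ℝ := 2 * π / L * (Nr + 1 / 2) with hℓ
  have hℓ₁0 : 0 < ℓ₁ := (by positivity); have hℓ0 : 0 < ℓ := by positivity
  have hℓNr : ℓ * Nr ≤ 1 := by
    rw [hℓ, div_mul_eq_mul_div, div_mul_eq_mul_div, div_le_one hL]; linarith only [hLN]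
  have hℓle1 : ℓ ≤ 1 := le_trans (le_mul_of_one_le_right hℓ0.le hNr1) hℓNr
  have hℓ₁ℓNr : ℓ₁ ≤ ℓ / Nr := by
    rw [hℓ, hℓ₁, le_div_iff₀ hNr0]
    exact mul_le_mul_of_nonneg_left (by linarith only []) (by positivity)
  have hℓ₁ℓ : ℓ₁ ≤ ℓ := hℓ₁ℓNr.trans (div_le_self hℓ0.le hNr1); have hℓ₁le1 : ℓ₁ ≤ 1 := hℓ₁ℓ.trans hℓle1
  have habs : |2 * π / (L : ℝ)| = ℓ₁ := abs_of_pos hℓ₁0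
  set ρf : ℝ := (klScale e₀ m + B.smax * B.Dtmin * (3 * sectorWidth (m + 1) / 4)) / (B.Dtmin - 2 * A) +
    π * Real.sqrt 2 * (1 + (4 + 2 * A) / (B.Dtmin - 2 * A)) * sectorWidth (m + 1) with hρf
  have hρf0 : 0 ≤ ρf := by rw [hρf]; have := B.smax_pos; have := B.Dtmin_pos; have := sectorWidth_pos (m + 1); positivity
  have hρfb : ρf ≤ cρ * π / Nr := by
    rw [hρf, hcρ, hw, hΛm]
    have h4Λ : 4 * Λ ≤ 2 * e₀ / π * (π / Nr) := by
      have e : 2 * e₀ / π * (π / Nr) = 2 * e₀ / Nr := by field_simp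
      rw [e, le_div_iff₀ hNr0]
      have := mul_le_mul_of_nonneg_left hNrΛ' (by norm_num : (0:ℝ) ≤ 4)
      linarith only [this]
    have hsm := B.smax_pos; have hdt := B.Dtmin_pos
    have e2 : ((2 * e₀ / π + B.smax * B.Dtmin * (3 / 4)) / (B.Dtmin - 2 * A) + π * Real.sqrt 2 * (1 + (4 + 2 * A) / (B.Dtmin - 2 * A))) * π / Nr =
        (2 * e₀ / π * (π / Nr) + B.smax * B.Dtmin * (3 * (π / Nr) / 4)) / (B.Dtmin - 2 * A) +
          π * Real.sqrt 2 * (1 + (4 + 2 * A) / (B.Dtmin - 2 * A)) * (π / Nr) := by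
      field_simp
    rw [e2]
    gcongr
  set s₀ : ℝ := 2 * Λs * β / ((M : ℝ) * π * X₀) with hs₀
  set s₁ : ℝ := 2 * Λs / (π * X₁) with hs₁
  set s₂ : ℝ := 2 * Λs / (π * (Nr + 1 / 2) * X₁) with hs₂
  set s₃ : ℝ := 2 / (π * (Nr + 1 / 2) * Nr * Real.sqrt qv) with hs₃
  set s₃' : ℝ := 2 * Λs / (π * (Nr + 1 / 2) * X₃) with hs₃'
  have hsv : 0 < Real.sqrt qv := Real.sqrt_pos.2 hqv0
  have hs₀0 : 0 < s₀ := (by positivity); have hs₁0 : 0 < s₁ := (by positivity); have hs₂0 : 0 < s₂ := by positivity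
  have hs₃0 : 0 < s₃ := (by positivity); have hs₃'0 : 0 < s₃' := by positivity
  have hsvsq : Real.sqrt qv ^ 2 = qv := Real.sq_sqrt hqv0.le
  have hc₀ : (0 : ℝ) ≤ (1 / (β * (L : ℝ) ^ 2)) ^ 2 := (by positivity); have hcβ : 0 ≤ β * (L : ℝ) ^ 2 := by positivity
  have hA₀ : 0 ≤ (1 / (β * (L : ℝ) ^ 2)) ^ 2 * (4 * (β * (L : ℝ) ^ 2) / Λs) := by positivity
  have hr₀ : (1 / (β * (L : ℝ) ^ 2)) ^ 2 *
      (1 * ((2 * π / β) ^ 3 * ((64 * B₃ + 480 * B₂ + 1728 * B₁ + 1536) * (β * (L : ℝ) ^ 2) / Λs ^ 4)) +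
        3 * ((2 * G₁ * |2 * π / β| * 1 / klScale e₀ m) * ((2 * π / β) ^ 2 * ((32 * B₂ + 144 * B₁ + 128) * (β * (L : ℝ) ^ 2) / Λs ^ 3))) +
        3 * (((4 * G₂ + 2 * G₁) * (2 * π / β) ^ 2 * 1 / klScale e₀ m ^ 2) * ((2 * π / β) * ((16 * B₁ + 16) * (β * (L : ℝ) ^ 2) / Λs ^ 2))) +
        ((8 * G₃ + 12 * G₂) * |2 * π / β| ^ 3 * 1 / klScale e₀ m ^ 3) * (4 * (β * (L : ℝ) ^ 2) / Λs)) ≤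
    (1 / (β * (L : ℝ) ^ 2)) ^ 2 * (4 * (β * (L : ℝ) ^ 2) / Λs) * (4 / (s₀ * (2 * M : ℕ))) ^ 3 := by
    have h4s : 0 < 4 * Λs := by positivity
    have hΛm4s : 4 * Λs ≤ klScale e₀ m := by rw [hΛm]; linarith only [hΛsΛ]
    have hmono : (1 / (β * (L : ℝ) ^ 2)) ^ 2 *
        (1 * ((2 * π / β) ^ 3 * ((64 * B₃ + 480 * B₂ + 1728 * B₁ + 1536) * (β * (L : ℝ) ^ 2) / Λs ^ 4)) +
          3 * ((2 * G₁ * |2 * π / β| * 1 / klScale e₀ m) * ((2 * π / β) ^ 2 * ((32 * B₂ + 144 * B₁ + 128) * (β * (L : ℝ) ^ 2) / Λs ^ 3))) +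
          3 * (((4 * G₂ + 2 * G₁) * (2 * π / β) ^ 2 * 1 / klScale e₀ m ^ 2) * ((2 * π / β) * ((16 * B₁ + 16) * (β * (L : ℝ) ^ 2) / Λs ^ 2))) +
          ((8 * G₃ + 12 * G₂) * |2 * π / β| ^ 3 * 1 / klScale e₀ m ^ 3) * (4 * (β * (L : ℝ) ^ 2) / Λs)) ≤
        (1 / (β * (L : ℝ) ^ 2)) ^ 2 *
        (1 * ((2 * π / β) ^ 3 * ((64 * B₃ + 480 * B₂ + 1728 * B₁ + 1536) * (β * (L : ℝ) ^ 2) / Λs ^ 4)) +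
          3 * ((2 * G₁ * |2 * π / β| * 1 / (4 * Λs)) * ((2 * π / β) ^ 2 * ((32 * B₂ + 144 * B₁ + 128) * (β * (L : ℝ) ^ 2) / Λs ^ 3))) +
          3 * (((4 * G₂ + 2 * G₁) * (2 * π / β) ^ 2 * 1 / (4 * Λs) ^ 2) * ((2 * π / β) * ((16 * B₁ + 16) * (β * (L : ℝ) ^ 2) / Λs ^ 2))) +
          ((8 * G₃ + 12 * G₂) * |2 * π / β| ^ 3 * 1 / (4 * Λs) ^ 3) * (4 * (β * (L : ℝ) ^ 2) / Λs)) := by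
      gcongr
    refine hmono.trans ?_
    rw [timeLeibniz3_eq (Λm := 4 * Λs) hβ hΛs rfl, ← hDt3]
    refine mul_le_mul_of_nonneg_left ?_ hA₀
    have e : (4 / (s₀ * (2 * M : ℕ))) ^ 3 = (π / β) ^ 3 * X₀ ^ 3 / Λs ^ 3 := by
      rw [hs₀]; push_cast; field_simp; norm_num
    rw [e, mul_div_assoc, mul_div_assoc]
    refine mul_le_mul_of_nonneg_left (div_le_div_of_nonneg_right hX₀c (pow_pos hΛs 3).le) (by positivity)
  have hAstep : ∀ t : ℝ, 0 ≤ t → t ≤ 1 →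
      2 * G₁ * ((4 + 2 * A) * t + Kp * (ρf + 2 * t) * t) / klScale e₀ m * 1 + 1 * 1 * (9 * (4 * Ba * ((1 + 2 * (sectorWidth (m + 1))⁻¹) * (2 * t)))) ≤
        t * ae1 / Λ ∧
      ((4 * G₂ + 2 * G₁) * ((4 + 2 * A) * t + Kp * (ρf + 2 * t) * t) ^ 2 / klScale e₀ m ^ 2 + 2 * G₁ * (Kp * t ^ 2) / klScale e₀ m) * 1 +
        4 * G₁ * ((4 + 2 * A) * t + Kp * (ρf + 2 * t) * t) / klScale e₀ m * (9 * (4 * Ba * ((1 + 2 * (sectorWidth (m + 1))⁻¹) * (2 * t)))) +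
        1 * 1 * (9 * (4 * Ba * ((1 + 2 * (sectorWidth (m + 1))⁻¹) * (2 * t)) ^ 2 + 8 * Ba ^ 2 * ((1 + 2 * (sectorWidth (m + 1))⁻¹) * (2 * t)) ^ 2)) ≤
        t ^ 2 * ae2 / Λ ^ 2 ∧
      κ₃F * t ^ 3 / klScale e₀ m ^ 3 ≤ t ^ 3 * (κ₃F / 64) / Λ ^ 3 := by
    intro t ht0 ht1
    refine ⟨?_, ?_, ?_⟩
    · have h := fatA1_step_le (A := A) (ρf := ρf) (wsi := (sectorWidth (m + 1))⁻¹) (e₀ := e₀) hG₁0 hKp0 hΛ hΛm hB0 ht0 ht1 hcρ0 hNr1 hρfb hwsi hNrΛ'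
      rw [hae1]; exact h
    · have h := fatA2_step_le (wsi := (sectorWidth (m + 1))⁻¹) hG₁0 hG₂0 hA0 hKp0 hρf0 hΛ hΛm hB0 hwsi0 ht0 ht1 hcρ0 hNr1 hρfb hwsi hNrΛ' hΛe
      rw [hae2]; exact h
    · rw [hΛm]; refine le_of_eq ?_; field_simp; ring
  have hrspace : ∀ t s : ℝ, 0 < t → t ≤ 1 → s = 2 * Λs / (π * (t * L / (2 * π)) * X₁) →
      (1 / (β * (L : ℝ) ^ 2)) ^ 2 *
        (1 * ((64 * B₃ + 480 * B₂ + 1728 * B₁ + 1536) * (β * (L : ℝ) ^ 2) / Λs ^ 4 * (K₁ * (Real.sqrt 2 * t) + 6 * (K₂ * (Real.sqrt 2 * t) ^ 2)) ^ 3 +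
            3 * ((32 * B₂ + 144 * B₁ + 128) * (β * (L : ℝ) ^ 2) / Λs ^ 3 * (K₁ * (Real.sqrt 2 * t) + 6 * (K₂ * (Real.sqrt 2 * t) ^ 2)) *
              (K₂ * (Real.sqrt 2 * t) ^ 2)) +
            (16 * B₁ + 16) * (β * (L : ℝ) ^ 2) / Λs ^ 2 * (K₃ * (Real.sqrt 2 * t) ^ 3)) +
          3 * ((2 * G₁ * ((4 + 2 * A) * t + Kp * (ρf + 2 * t) * t) / klScale e₀ m * 1 +
                1 * 1 * (9 * (4 * Ba * ((1 + 2 * (sectorWidth (m + 1))⁻¹) * (2 * t))))) *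
            ((32 * B₂ + 144 * B₁ + 128) * (β * (L : ℝ) ^ 2) / Λs ^ 3 * (K₁ * (Real.sqrt 2 * t) + 5 * (K₂ * (Real.sqrt 2 * t) ^ 2)) ^ 2 +
              (16 * B₁ + 16) * (β * (L : ℝ) ^ 2) / Λs ^ 2 * (K₂ * (Real.sqrt 2 * t) ^ 2))) +
          3 * ((((4 * G₂ + 2 * G₁) * ((4 + 2 * A) * t + Kp * (ρf + 2 * t) * t) ^ 2 / klScale e₀ m ^ 2 + 2 * G₁ * (Kp * t ^ 2) / klScale e₀ m) * 1 +
                4 * G₁ * ((4 + 2 * A) * t + Kp * (ρf + 2 * t) * t) / klScale e₀ m * (9 * (4 * Ba * ((1 + 2 * (sectorWidth (m + 1))⁻¹) * (2 * t)))) +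
                1 * 1 * (9 * (4 * Ba * ((1 + 2 * (sectorWidth (m + 1))⁻¹) * (2 * t)) ^ 2 + 8 * Ba ^ 2 * ((1 + 2 * (sectorWidth (m + 1))⁻¹) * (2 * t)) ^ 2))) *
            ((16 * B₁ + 16) * (β * (L : ℝ) ^ 2) / Λs ^ 2 * (K₁ * (Real.sqrt 2 * t) + 4 * (K₂ * (Real.sqrt 2 * t) ^ 2)))) +
          κ₃F * t ^ 3 / klScale e₀ m ^ 3 * (4 * (β * (L : ℝ) ^ 2) / Λs)) ≤
      (1 / (β * (L : ℝ) ^ 2)) ^ 2 * (4 * (β * (L : ℝ) ^ 2) / Λs) * (4 / (s * L)) ^ 3 := by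
    intro t s ht0 ht1 hs
    obtain ⟨h1, h2, h3'⟩ := hAstep t ht0.le ht1
    have h1' := h1.trans (div_le_div_of_nonneg_left (by positivity : 0 ≤ t * ae1) hΛs hΛsΛ)
    have h2' := h2.trans (div_le_div_of_nonneg_left (by positivity : 0 ≤ t ^ 2 * ae2) (by positivity) (pow_le_pow_left₀ hΛs.le hΛsΛ 2))
    have h3'' := h3'.trans (div_le_div_of_nonneg_left (by positivity : 0 ≤ t ^ 3 * (κ₃F / 64)) (by positivity) (pow_le_pow_left₀ hΛs.le hΛsΛ 3))
    have h := spaceLeibniz3_le (c₀ := (1 / (β * (L : ℝ) ^ 2)) ^ 2) (c := β * (L : ℝ) ^ 2) (C₁ := 16 * B₁ + 16) (C₂ := 32 * B₂ + 144 * B₁ + 128)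
      (C₃ := 64 * B₃ + 480 * B₂ + 1728 * B₁ + 1536)
      hc₀ hcβ (by positivity) (by positivity) (by positivity) hK10 hK20 hK30 hΛs hΛse ht0.le ht1 hae10 hae20 h1' h2' h3''
    refine h.trans ?_
    rw [← hq3e]
    refine mul_le_mul_of_nonneg_left ?_ hA₀
    have e : (4 / (s * L)) ^ 3 = t ^ 3 * X₁ ^ 3 / Λs ^ 3 := by rw [hs]; field_simp; norm_num
    rw [e, mul_div_assoc, mul_div_assoc]
    exact mul_le_mul_of_nonneg_left (div_le_div_of_nonneg_right hX₁c (pow_pos hΛs 3).le) (by positivity)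
  have hr₁ := hrspace ℓ₁ s₁ hℓ₁0 hℓ₁le1 (by rw [hs₁, hℓ₁]; field_simp)
  have hr₂ := hrspace ℓ s₂ hℓ0 hℓle1 (by rw [hs₂, hℓ]; field_simp)
  have hτt : |2 * π / (L : ℝ)| * (4 + 2 * A) + K₂ * (Real.sqrt 2 * ρf) * (Real.sqrt 2 * ℓ) ≤ ℓ / Nr * bτ := by
    rw [habs, hbτ]; exact tangentTau_le hA0 hK20 hℓ0.le hNr0 hℓ₁ℓNr hρfb
  have hτt' : |2 * π / (L : ℝ)| * (4 + 2 * A) + K₂ * (Real.sqrt 2 * ρf) * (Real.sqrt 2 * ℓ) ≤ ℓ * bτ :=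
    hτt.trans (mul_le_mul_of_nonneg_right (div_le_self hℓ0.le hNr1) hbτ0)
  have hτt0 : 0 ≤ |2 * π / (L : ℝ)| * (4 + 2 * A) + K₂ * (Real.sqrt 2 * ρf) * (Real.sqrt 2 * ℓ) := by positivity
  have hl1abs : |2 * π / (L : ℝ)| ≤ ℓ / Nr := by rw [habs]; exact hℓ₁ℓNr
  have hAv1 := fatA1_tangent_le (wsi := (sectorWidth (m + 1))⁻¹) hG₁0 hA0 hKp0 hΛ hΛm hB0 hℓ0.le hNr1 hl1abs hρfb hℓNr hwsi hNrΛ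
  have hAv2 := fatA2_tangent_le (wsi := (sectorWidth (m + 1))⁻¹) hG₁0 hG₂0 hA0 hKp0 hρf0 hΛ hΛm hB0 hℓ0.le (abs_nonneg (2 * π / (L : ℝ))) hNr1
    hl1abs hρfb hℓNr hwsi hwsi0 hNrΛ
  have hAv1' := hAv1
  rw [← hav1] at hAv1'
  have hAv2' := hAv2
  rw [← hav2] at hAv2'
  have hr₃ : (1 / (β * (L : ℝ) ^ 2)) ^ 2 *
      (1 * ((32 * B₂ + 144 * B₁ + 128) * (β * (L : ℝ) ^ 2) / Λs ^ 3 *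
            (|2 * π / (L : ℝ)| * (4 + 2 * A) + K₂ * (Real.sqrt 2 * ρf) * (Real.sqrt 2 * ℓ) + 4 * (K₂ * (Real.sqrt 2 * ℓ) ^ 2)) ^ 2 +
          (16 * B₁ + 16) * (β * (L : ℝ) ^ 2) / Λs ^ 2 * (K₂ * (Real.sqrt 2 * ℓ) ^ 2)) +
        2 * ((2 * G₁ * (|2 * π / (L : ℝ)| * (4 + 2 * A) + Kp * (ρf + 2 * ℓ) * ℓ) / klScale e₀ m * 1 +
              1 * 1 * (9 * (4 * Ba * ((1 + 2 * (sectorWidth (m + 1))⁻¹) * (2 * ℓ))))) *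
          ((16 * B₁ + 16) * (β * (L : ℝ) ^ 2) / Λs ^ 2 *
            (|2 * π / (L : ℝ)| * (4 + 2 * A) + K₂ * (Real.sqrt 2 * ρf) * (Real.sqrt 2 * ℓ) + 3 * (K₂ * (Real.sqrt 2 * ℓ) ^ 2)))) +
        (((4 * G₂ + 2 * G₁) * (|2 * π / (L : ℝ)| * (4 + 2 * A) + Kp * (ρf + 2 * ℓ) * ℓ) ^ 2 / klScale e₀ m ^ 2 + 2 * G₁ * (Kp * ℓ ^ 2) / klScale e₀ m) * 1 +
          4 * G₁ * (|2 * π / (L : ℝ)| * (4 + 2 * A) + Kp * (ρf + 2 * ℓ) * ℓ) / klScale e₀ m * (9 * (4 * Ba * ((1 + 2 * (sectorWidth (m + 1))⁻¹) * (2 * ℓ)))) +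
          1 * 1 * (9 * (4 * Ba * ((1 + 2 * (sectorWidth (m + 1))⁻¹) * (2 * ℓ)) ^ 2 + 8 * Ba ^ 2 * ((1 + 2 * (sectorWidth (m + 1))⁻¹) * (2 * ℓ)) ^ 2))) *
          (4 * (β * (L : ℝ) ^ 2) / Λs)) ≤
    (1 / (β * (L : ℝ) ^ 2)) ^ 2 * (4 * (β * (L : ℝ) ^ 2) / Λs) * (4 / (s₃ * L)) ^ 2 := by
    have h := tangentLeibniz_le (c₀ := (1 / (β * (L : ℝ) ^ 2)) ^ 2) (c := β * (L : ℝ) ^ 2) (C₁ := 16 * B₁ + 16) (C₂ := 32 * B₂ + 144 * B₁ + 128)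
      hc₀ hcβ (by positivity) (by positivity) hK20 hΛs hℓ0.le hNr1 hℓNr hNrΛs hτt0 hτt hav10 hAv1' hAv2'
    refine h.trans (le_of_eq ?_)
    rw [← hqv, hs₃, hℓ]
    field_simp
    rw [hsvsq]; ring
  have hAv1'' : 2 * G₁ * (|2 * π / (L : ℝ)| * (4 + 2 * A) + Kp * (ρf + 2 * ℓ) * ℓ) / klScale e₀ m * 1 +
      1 * 1 * (9 * (4 * Ba * ((1 + 2 * (sectorWidth (m + 1))⁻¹) * (2 * ℓ)))) ≤ ℓ * (e₀ * av1 / 2) / Λ := by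
    refine hAv1'.trans ?_
    have e : ℓ * (e₀ * av1 / 2) / Λ = ℓ * (e₀ / 2 / Λ) * av1 := by field_simp
    rw [e]
    have hNr' : Nr ≤ e₀ / 2 / Λ := by rw [le_div_iff₀ hΛ]; exact hNrΛ'
    gcongr
  have hAv2'' : ((4 * G₂ + 2 * G₁) * (|2 * π / (L : ℝ)| * (4 + 2 * A) + Kp * (ρf + 2 * ℓ) * ℓ) ^ 2 / klScale e₀ m ^ 2 + 2 * G₁ * (Kp * ℓ ^ 2) / klScale e₀ m) * 1 +
      4 * G₁ * (|2 * π / (L : ℝ)| * (4 + 2 * A) + Kp * (ρf + 2 * ℓ) * ℓ) / klScale e₀ m * (9 * (4 * Ba * ((1 + 2 * (sectorWidth (m + 1))⁻¹) * (2 * ℓ)))) +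
      1 * 1 * (9 * (4 * Ba * ((1 + 2 * (sectorWidth (m + 1))⁻¹) * (2 * ℓ)) ^ 2 + 8 * Ba ^ 2 * ((1 + 2 * (sectorWidth (m + 1))⁻¹) * (2 * ℓ)) ^ 2)) ≤
      ℓ ^ 2 * (e₀ ^ 2 * av2) / Λ ^ 2 := by
    refine hAv2'.trans ?_
    have e : ℓ ^ 2 * Nr ^ 2 * av2 = ℓ ^ 2 * (e₀ * Λ * av2) / Λ ^ 2 := by rw [← hNrΛ]; field_simp
    rw [e]
    have : e₀ * Λ * av2 ≤ e₀ ^ 2 * av2 := by rw [pow_two]; gcongr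
    gcongr
  have hr₃' : (1 / (β * (L : ℝ) ^ 2)) ^ 2 *
      (1 * ((64 * B₃ + 480 * B₂ + 1728 * B₁ + 1536) * (β * (L : ℝ) ^ 2) / Λs ^ 4 *
            (|2 * π / (L : ℝ)| * (4 + 2 * A) + K₂ * (Real.sqrt 2 * ρf) * (Real.sqrt 2 * ℓ) + 6 * (K₂ * (Real.sqrt 2 * ℓ) ^ 2)) ^ 3 +
          3 * ((32 * B₂ + 144 * B₁ + 128) * (β * (L : ℝ) ^ 2) / Λs ^ 3 *
            (|2 * π / (L : ℝ)| * (4 + 2 * A) + K₂ * (Real.sqrt 2 * ρf) * (Real.sqrt 2 * ℓ) + 6 * (K₂ * (Real.sqrt 2 * ℓ) ^ 2)) * (K₂ * (Real.sqrt 2 * ℓ) ^ 2)) +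
          (16 * B₁ + 16) * (β * (L : ℝ) ^ 2) / Λs ^ 2 * (K₃ * (Real.sqrt 2 * ℓ) ^ 3)) +
        3 * ((2 * G₁ * (|2 * π / (L : ℝ)| * (4 + 2 * A) + Kp * (ρf + 2 * ℓ) * ℓ) / klScale e₀ m * 1 +
              1 * 1 * (9 * (4 * Ba * ((1 + 2 * (sectorWidth (m + 1))⁻¹) * (2 * ℓ))))) *
          ((32 * B₂ + 144 * B₁ + 128) * (β * (L : ℝ) ^ 2) / Λs ^ 3 *
              (|2 * π / (L : ℝ)| * (4 + 2 * A) + K₂ * (Real.sqrt 2 * ρf) * (Real.sqrt 2 * ℓ) + 5 * (K₂ * (Real.sqrt 2 * ℓ) ^ 2)) ^ 2 +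
            (16 * B₁ + 16) * (β * (L : ℝ) ^ 2) / Λs ^ 2 * (K₂ * (Real.sqrt 2 * ℓ) ^ 2))) +
        3 * ((((4 * G₂ + 2 * G₁) * (|2 * π / (L : ℝ)| * (4 + 2 * A) + Kp * (ρf + 2 * ℓ) * ℓ) ^ 2 / klScale e₀ m ^ 2 +
                2 * G₁ * (Kp * ℓ ^ 2) / klScale e₀ m) * 1 +
              4 * G₁ * (|2 * π / (L : ℝ)| * (4 + 2 * A) + Kp * (ρf + 2 * ℓ) * ℓ) / klScale e₀ m * (9 * (4 * Ba * ((1 + 2 * (sectorWidth (m + 1))⁻¹) * (2 * ℓ)))) +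
              1 * 1 * (9 * (4 * Ba * ((1 + 2 * (sectorWidth (m + 1))⁻¹) * (2 * ℓ)) ^ 2 + 8 * Ba ^ 2 * ((1 + 2 * (sectorWidth (m + 1))⁻¹) * (2 * ℓ)) ^ 2))) *
          ((16 * B₁ + 16) * (β * (L : ℝ) ^ 2) / Λs ^ 2 *
            (|2 * π / (L : ℝ)| * (4 + 2 * A) + K₂ * (Real.sqrt 2 * ρf) * (Real.sqrt 2 * ℓ) + 4 * (K₂ * (Real.sqrt 2 * ℓ) ^ 2)))) +
        κ₃F * ℓ ^ 3 / klScale e₀ m ^ 3 * (4 * (β * (L : ℝ) ^ 2) / Λs)) ≤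
    (1 / (β * (L : ℝ) ^ 2)) ^ 2 * (4 * (β * (L : ℝ) ^ 2) / Λs) * (4 / (s₃' * L)) ^ 3 := by
    have h3' := (hAstep ℓ hℓ0.le hℓle1).2.2
    have h1s := hAv1''.trans (div_le_div_of_nonneg_left (by positivity : 0 ≤ ℓ * (e₀ * av1 / 2)) hΛs hΛsΛ)
    have h2s := hAv2''.trans (div_le_div_of_nonneg_left (by positivity : 0 ≤ ℓ ^ 2 * (e₀ ^ 2 * av2)) (by positivity) (pow_le_pow_left₀ hΛs.le hΛsΛ 2))
    have h3s := h3'.trans (div_le_div_of_nonneg_left (by positivity : 0 ≤ ℓ ^ 3 * (κ₃F / 64)) (by positivity) (pow_le_pow_left₀ hΛs.le hΛsΛ 3))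
    have h := tangentLeibniz3_le (c₀ := (1 / (β * (L : ℝ) ^ 2)) ^ 2) (c := β * (L : ℝ) ^ 2) (C₁ := 16 * B₁ + 16) (C₂ := 32 * B₂ + 144 * B₁ + 128)
      (C₃ := 64 * B₃ + 480 * B₂ + 1728 * B₁ + 1536)
      hc₀ hcβ (by positivity) (by positivity) (by positivity) hK20 hK30 hΛs hΛse hℓ0.le hℓle1 hτt0 hbτ0 hτt' (by positivity) (by positivity)
      h1s h2s h3s
    refine h.trans ?_
    rw [← hq3v]
    refine mul_le_mul_of_nonneg_left ?_ hA₀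
    have e : (4 / (s₃' * L)) ^ 3 = ℓ ^ 3 * X₃ ^ 3 / Λs ^ 3 := by rw [hs₃', hℓ]; field_simp; norm_num
    rw [e, mul_div_assoc, mul_div_assoc]
    exact mul_le_mul_of_nonneg_left (div_le_div_of_nonneg_right hX₃c (pow_pos hΛs 3).le) (by positivity)
  have hlo' : a ≤ μ - A := (by linarith only [hlo, he]); have hhi' : μ + A ≤ b := by linarith only [hhi, he]
  set pF : Fin 2 → ℝ := klFermiPoint μ K (sectorCenter (m + 1) (ω : ℕ)) with hpF
  set eK : (Fin 2 → ℝ) → ℝ := fun p => frameLevel μ K (WithLp.toLp 2 p) with heK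
  set g₀ : ℝ := fderiv ℝ eK pF (Pi.single 0 1) with hg₀
  set g₁ : ℝ := fderiv ℝ eK pF (Pi.single 1 1) with hg₁
  have hN0 : 0 < Real.sqrt (g₀ ^ 2 + g₁ ^ 2) := lt_of_lt_of_le hγ (gradient_floor_klFermiPoint B hA hlo' hhi' (sectorCenter (m + 1) (ω : ℕ)))
  obtain ⟨v, hv⟩ : ∃ v : Fin 2 → ℤ, v = ![round (Nr * (-g₁ / Real.sqrt (g₀ ^ 2 + g₁ ^ 2))), round (Nr * (g₀ / Real.sqrt (g₀ ^ 2 + g₁ ^ 2)))] :=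
    ⟨_, rfl⟩
  have hv0 : v 0 = round (Nr * (-g₁ / Real.sqrt (g₀ ^ 2 + g₁ ^ 2))) := (by rw [hv]; rfl); have hv1 : v 1 = round (Nr * (g₀ / Real.sqrt (g₀ ^ 2 + g₁ ^ 2))) := by rw [hv]; rfl
  obtain ⟨htan, hvj, hvne⟩ := tangentStep_bounds eK pF (norm_fderiv_frameBand_le hA μ pF) hN0 hNr1 v hv0 hv1 (2 * π / L)
  have hunit : (-g₁ / Real.sqrt (g₀ ^ 2 + g₁ ^ 2)) ^ 2 + (g₀ / Real.sqrt (g₀ ^ 2 + g₁ ^ 2)) ^ 2 = 1 := by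
    have h := (frame_orthonormal hN0).2.1
    rw [neg_div]; exact h
  have hvlen : Nr - 1 ≤ Real.sqrt ((v 0 : ℝ) ^ 2 + (v 1 : ℝ) ^ 2) := by
    have h := sub_one_le_sqrt_sum_sq_round hNr2 (u := ![-g₁ / Real.sqrt (g₀ ^ 2 + g₁ ^ 2), g₀ / Real.sqrt (g₀ ^ 2 + g₁ ^ 2)]) hunit
    rw [hv0, hv1]
    exact h
  have hT := slicePairWt_bgmFat_le B hA hADt he hz hz1 hgap h3 hlo hhi hβ hρA m hMm hd hd1 hd2 hd3 hA3 ha3 hB0 hB hB30 hB3 hΛs hΛΛ' hM' hK₁ hK₂ hK₃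
    hB₁ hB₂ hB₃ hNr2 hLz hR₀ rfl rfl rfl hG₁ hG₂ hG₃ hκ₃F hKp rfl rfl rfl rfl rfl rfl rfl rfl ω ω' v hvne hvj hvlen htan
    hs₀0 hs₁0 hs₂0 hs₃0 hs₃'0 hr₀ hr₁ hr₂ hr₃ hr₃'
  exact hT

end Closed

end Summit.HubbardSuperconductivity.HubbardSuperconductivity.Theorems.TorusFourierL2

end
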